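import Summits.HubbardSuperconductivity.HubbardSuperconductivity.Theorems.SoloBlindCooperBracket
import HarnessLib

/-!
# Scalar inequalities for the Cooper trial state (solo-blind programme, Theorem 29, arithmetic)

The elementary real inequalities used by `SoloBlindCooperPairing`: admissibility of the gain
amplitudes `r/3` against the reciprocal weights `r^{±2}` (`0 < r ≤ 1`), the four per-mode cost
bounds (window particle / window hole / far particle / core hole), and the Cooper-logarithm
arithmetic `4S/q² - (g/L²)(7S/15q)² ≤ -4A L²/q²` under `(49g/225)S ≥ 8L²`, `S ≥ A L²`.
[this work]
-/

noncomputable section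

namespace Summit.HubbardSuperconductivity.HubbardSuperconductivity.Theorems.CooperPairing

open Real

/-- `7/10 ≤ √2/2`. -/
theorem seven_tenths_le_sqrt_two_div_two : (7 : ℝ) / 10 ≤ Real.sqrt 2 / 2 := by
  nlinarith [Real.sqrt_nonneg 2, Real.sq_sqrt (show (0 : ℝ) ≤ 2 by norm_num)]

/-- Admissibility of the gain amplitude `r/3` against the weight `r²` (`0 < r ≤ 1`). -/
theorem adm_particle {r : ℝ} (h0 : 0 < r) (h1 : r ≤ 1) :
    (r / 3) ^ 2 * ((1 + r ^ 2) * (2 + r ^ 2)) ≤ r ^ 2 := by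
  have hr2 : r ^ 2 ≤ 1 := by nlinarith
  have hP : (1 + r ^ 2) * (2 + r ^ 2) ≤ 6 := by nlinarith [sq_nonneg r]
  calc (r / 3) ^ 2 * ((1 + r ^ 2) * (2 + r ^ 2))
      = r ^ 2 / 9 * ((1 + r ^ 2) * (2 + r ^ 2)) := by ring
    _ ≤ r ^ 2 / 9 * 6 := by gcongr
    _ ≤ r ^ 2 := by nlinarith [sq_nonneg r]

/-- Admissibility of the gain amplitude `r/3` against the weight `r⁻²` (`0 < r ≤ 1`). -/
theorem adm_hole {r : ℝ} (h0 : 0 < r) (h1 : r ≤ 1) :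
    (r / 3) ^ 2 * ((1 + (r ^ 2)⁻¹) * (2 + (r ^ 2)⁻¹)) ≤ (r ^ 2)⁻¹ := by
  have hr2 : r ^ 2 ≤ 1 := by nlinarith
  have hP : (r ^ 2 + 1) * (2 * r ^ 2 + 1) ≤ 6 := by nlinarith [sq_nonneg r]
  have e : (r / 3) ^ 2 * ((1 + (r ^ 2)⁻¹) * (2 + (r ^ 2)⁻¹)) =
      (r ^ 2 + 1) * (2 * r ^ 2 + 1) / (9 * r ^ 2) := by
    field_simp
    ring
  rw [e, div_le_iff₀ (by positivity)]
  have e2 : (r ^ 2)⁻¹ * (9 * r ^ 2) = 9 := by field_simp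
  rw [e2]
  linarith

/-- A window particle: `(ε-μ)·2x/(1+2x) ≤ η·2x` for `0 ≤ ε-μ ≤ η`, `x = r²`. -/
theorem term_particle {c η r : ℝ} (hc0 : 0 ≤ c) (hc : c ≤ η) :
    c * (2 * r ^ 2 / (1 + 2 * r ^ 2)) ≤ η * (2 * r ^ 2) := by
  have hfrac : 2 * r ^ 2 / (1 + 2 * r ^ 2) ≤ 2 * r ^ 2 := by
    rw [div_le_iff₀ (by positivity)]
    nlinarith [sq_nonneg r, sq_nonneg (r ^ 2)]
  exact mul_le_mul hc hfrac (by positivity) (by linarith)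

/-- A window hole: `(μ-ε)·2/(2+x) ≤ η·2r²` for `0 ≤ μ-ε ≤ η`, `x = r⁻²`, `r > 0`. -/
theorem term_hole {c η r : ℝ} (hc0 : 0 ≤ c) (hc : c ≤ η) (hr : 0 < r) :
    c * (2 / (2 + (r ^ 2)⁻¹)) ≤ η * (2 * r ^ 2) := by
  have hfrac : 2 / (2 + (r ^ 2)⁻¹) ≤ 2 * r ^ 2 := by
    rw [div_le_iff₀ (by positivity)]
    have e : 2 * r ^ 2 * (2 + (r ^ 2)⁻¹) = 4 * r ^ 2 + 2 := by
      field_simp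
      ring
    rw [e]
    nlinarith [sq_nonneg r]
  exact mul_le_mul hc hfrac (by positivity) (by linarith)

/-- A far particle: `(ε-μ)·2x/(1+2x) ≤ 12/X` for `0 ≤ ε-μ ≤ 6`, `x = 1/X`. -/
theorem term_far {c X : ℝ} (hc : c ≤ 6) (hX : 0 < X) :
    c * (2 * (1 / X) / (1 + 2 * (1 / X))) ≤ 12 / X := by
  have hfrac : 2 * (1 / X) / (1 + 2 * (1 / X)) ≤ 2 / X := by
    rw [div_le_div_iff₀ (by positivity) hX]
    have e : 2 * (1 / X) * X = 2 := by field_simp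
    rw [e]
    nlinarith
  calc c * (2 * (1 / X) / (1 + 2 * (1 / X)))
      ≤ 6 * (2 / X) := mul_le_mul hc hfrac (by positivity) (by norm_num)
    _ = 12 / X := by ring

/-- A core hole: `(μ-ε)·2/(2+X) ≤ 8/X` for `0 ≤ μ-ε ≤ 4`. -/
theorem term_core {c X : ℝ} (hc : c ≤ 4) (hX : 0 < X) :
    c * (2 / (2 + X)) ≤ 8 / X := by
  have hfrac : 2 / (2 + X) ≤ 2 / X := div_le_div_of_nonneg_left (by norm_num) hX (by linarith)
  calc c * (2 / (2 + X)) ≤ 4 * (2 / X) := mul_le_mul hc hfrac (by positivity) (by norm_num)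
    _ = 8 / X := by ring

/-- The Cooper-logarithm arithmetic: cost `4S/q²` against gain `(g/L²)(7S/15q)²` when
`(49g/225)S ≥ 8L²` and `S ≥ (J+1)σL²`. -/
theorem main_ineq {S q g L2 A : ℝ} (hS0 : 0 ≤ S) (hq : 0 < q) (hL2 : 0 < L2)
    (hA : A * L2 ≤ S) (hS8 : 8 * L2 ≤ 49 * g / 225 * S) :
    4 * (S / q ^ 2) - g / L2 * (7 / 15 * (S / q)) ^ 2 ≤ -(4 * A / q ^ 2) * L2 := by
  have e1 : g / L2 * (7 / 15 * (S / q)) ^ 2 = (49 * g / 225 * S) * S / L2 / q ^ 2 := by ring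
  have h2 : 8 * L2 * S / L2 / q ^ 2 ≤ (49 * g / 225 * S) * S / L2 / q ^ 2 :=
    div_le_div_of_nonneg_right (div_le_div_of_nonneg_right
      (mul_le_mul_of_nonneg_right hS8 hS0) hL2.le) (by positivity)
  have e2 : 8 * L2 * S / L2 / q ^ 2 = 8 * (S / q ^ 2) := by
    field_simp
  have h3 : 4 * A / q ^ 2 * L2 ≤ 4 * (S / q ^ 2) := by
    have := div_le_div_of_nonneg_right hA (le_of_lt (pow_pos hq 2))
    have e3 : 4 * A / q ^ 2 * L2 = 4 * (A * L2 / q ^ 2) := by ring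
    rw [e3]
    linarith
  rw [e1]
  rw [e2] at h2
  linarith

end Summit.HubbardSuperconductivity.HubbardSuperconductivity.Theorems.CooperPairing
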